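/-
Copyright (c) 2026 the pub-hodgecm-mathlib formalisation cell (harness21).  Prover seat hodgecm-mathlib-LH4-p12 (g7), req620 Track A «(D-RAM) FOUR-FRAME» squad
(LH4-r01 (g7) 09:35:14Z cross-sheet defect «`hfin : ∀ T, …` is unsatisfiable»; dealer LH4-plan (g12) WORD #39); helper lane `--supports stmt-HodgeConjecture-24833`.  2026-09-04.
-/
import Summits.HodgeConjecture.HodgeConjecture.Theorems.F0P3cDyRamFixedCountDiagonalModel   -- ★ p855032 (LH4-p10 (g0)): `exists_unimodular_diagonal_frame`; brings ★ `isVertexLattice_formCongr_iff`, `mapGL_conj_mapGL_eq_iff`, `mapGL_mapGL_inv`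
import Summits.HodgeConjecture.HodgeConjecture.Theorems.F0P3cDyRamDiagonalFixedFinite       -- ★ (LH4-p12 lineage, TARGET F∕H): `finite_setOf_isVertexLattice_mapGL_diagonal_eq`
import HarnessLib

/-!
# Crux `H413`, line LH4 «(D-RAM) FOUR-FRAME» road — THE FIXED TYPE-`t` VERTEX SET OF A REGULAR FOUR-FRAME LITERAL IS FINITE, in the census set-builder currency
# `{M | IsVertexLattice σ ϖ Φ₃ t M ∧ mapGL Γ M = M}` of ★ U2G DEFS ∕ ★ p858722 ∕ ★ p858960

Cell `hodgecm-mathlib` (D-0151), FLOOR 0, crux item H413 = `stmt-HodgeConjecture-24833`, route of record `HCCMUnconditional`; squad F0∕P3c∕LH4 (req618∕req620).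
THEOREMS ONLY (no `def`, no instance, no notation, no `sorry`, default heartbeats); lane `--supports stmt-HodgeConjecture-24833 --as helper` (count-neutral).  A STAGE-1b
PRE-BRICK (T19-24 clause).  WHY: the census splits ★ p858722 (`ncard_sqLevel_add_regFixCount_eq_fixedVertexCount`, `transvPlusFixCount_add_transvMinusFixCount`), the
reductions ★ p858960 (`regFixCount_eq_sub`, …) and the STAGE-1b signature scratches ((L-sq) ∕ (L-lev) ∕ (L-T+)) all carry the finiteness of the fixed type-`0` vertex set of
the frame literal `Γ_b` in the SET-BUILDER currency `{M : Submodule 𝒪[K] (Fin 3 → K) | IsVertexLattice σ ϖ Φ₃ t M ∧ mapGL Γ M = M}`; LH4-r01 (g7) 09:35:14Z pointed out that the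
lazy quantification `∀ T : GL₃(K), (…).Finite` is UNSATISFIABLE (the `T = 1` fixed set is every type-`0` vertex — the tree is infinite), while the frame-wise statement is true but
so far ★ only in the vertex-subtype currency (★ `finite_fixedVertices_frameElt`) and in the diagonal model (★ `finite_setOf_isVertexLattice_mapGL_diagonal_eq`).  THIS FILE
transports the latter to the set-builder currency at the frame literal: for a four-frame family `f`, `α, β ∈ E¹` REGULAR (`α ≠ β`, `α ≠ 1`, `β ≠ 1` — conjuncts of `IsElementDatum`)
and `(Γ : M₃) = frameElt σ f b α β`, the set `{M | IsVertexLattice σ ϖ Φ₃ t M ∧ ΓM = M}` is FINITE for every type `t` (residue field finite, datum ramified: `σ`-fixed elements have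
even valuation).  PROOF: ★ `exists_unimodular_diagonal_frame` writes `Γ = A·diag(α, β, 1)·A⁻¹` with `ᵗσ(A)Φ₃A = diag(d)`, `d` units; `M ↦ A·M` maps the diagonal model's fixed set
ONTO ours (★ `isVertexLattice_formCongr_iff`, ★ `mapGL_conj_mapGL_eq_iff`, ★ `mapGL_mapGL_inv` — the bijection of ★ `ncard_fixed_formCongr_eq`), and the model set is finite by
★ `finite_setOf_isVertexLattice_mapGL_diagonal_eq` (regular unit diagonal).

* `exists_GL_coe_eq_diagonal` — `diag(α, β, 1) ∈ GL₃` for units `α, β`.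
* **`finite_setOf_isVertexLattice_mapGL_frameElt`** — THE HEAD; `finite_setOf_isVertexLattice_mapGL_frameElt_sq` — the reading at the square parameters `(a², b²)` of the
  κ-law binders (★ №1-R2 `KappaSignLawAtS2`: `IsElementDatum σ ϖ N₀ (a·a) (b·b) …`, `Γ b′ = frameElt σ f b′ (a·a) (b·b)`), for all four frames at once.

HONEST LABEL.  Count-neutral helper: states no law, pays no stub; the three tier-0 rows stay OPEN; `HC_CM` is proved only modulo the 7 printed citations (2 remaining named inputs:
hLiu418 = `stmt-HodgeConjecture-24832`, h413 = `stmt-HodgeConjecture-24833`) until rung 0 closes.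

## References
* [Kottwitz1986BaseChangeUnits] R. E. Kottwitz, *Base change for unit elements of Hecke algebras*, Compositio Math. 60 (1986), §1 pp. 240–241 (fixed lattices of a regular
  elliptic element are finite in number).
* [BruhatTits1972] F. Bruhat, J. Tits, *Groupes réductifs sur un corps local I*, Publ. Math. IHÉS 41 (1972), §10 (change of frame on the building).
* [Rogawski1990] J. D. Rogawski, *Automorphic Representations of Unitary Groups in Three Variables*, Ann. of Math. Stud. 123 (1990), §4.9 pp. 54–55, Lemma 4.9.3.
-/

set_option autoImplicit false

noncomputable section

namespace Summit.HodgeConjecture.HodgeConjecture.Cruxes.H413.F0P3cDyRamFrameEltFixedFinite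

open Literature.NumberTheory.Automorphic Literature.NumberTheory.Automorphic.UnitaryLatticeTree Literature.NumberTheory.Automorphic.HermitianLattice
open Literature.NumberTheory.Automorphic.UnitaryThreeFourFrame
open Summit.HodgeConjecture.HodgeConjecture.Cruxes.H413.F0P3cDyRamFixedCountDiagonalModel (exists_unimodular_diagonal_frame)
open Summit.HodgeConjecture.HodgeConjecture.Cruxes.H413.F0P3cDyRamDiagonalFixedFinite (finite_setOf_isVertexLattice_mapGL_diagonal_eq)
open scoped Matrix MatrixGroups Valued WithZero

variable {K : Type} [Field K] [Valued K ℤᵐ⁰] {σ : K →+* K} {ϖ : K}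

/-- `diag(α, β, 1) ∈ GL₃(K)` when `α, β` are units (valuation `1`). [cite: Rogawski1990, §4.9 p. 54] -/
theorem exists_GL_coe_eq_diagonal {α β : K} (hα : Valued.v α = 1) (hβ : Valued.v β = 1) :
    ∃ T : GL (Fin 3) K, (T : Matrix (Fin 3) (Fin 3) K) = Matrix.diagonal ![α, β, 1] := by
  have hs1 : ∀ i, Valued.v ((![α, β, 1] : Fin 3 → K) i) = 1 := by
    intro i; fin_cases i <;> simp [hα, hβ]
  have hdet : (Matrix.diagonal (![α, β, 1] : Fin 3 → K)).det ≠ 0 := by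
    rw [Matrix.det_diagonal]
    exact Finset.prod_ne_zero_iff.2 fun i _ => (Valuation.ne_zero_iff (Valued.v)).1 (by rw [hs1 i]; exact one_ne_zero)
  exact ⟨Matrix.GeneralLinearGroup.mkOfDetNeZero _ hdet, rfl⟩

/-- **THE FIXED TYPE-`t` VERTEX SET OF A REGULAR FOUR-FRAME LITERAL IS FINITE** (set-builder currency).  At a ramified datum (`σ` an isometric involution whose fixed elements have even
valuation, `ϖ` a uniformiser, finite residue field), for a four-frame family `f`, frame `b`, `α, β ∈ E¹` with `α ≠ β`, `α ≠ 1`, `β ≠ 1` and `(Γ : M₃) = frameElt σ f b α β`: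
`{M | IsVertexLattice σ ϖ Φ₃ t M ∧ Γ·M = M}` is finite.  (★ `exists_unimodular_diagonal_frame` + the bijection `M ↦ A·M` of ★ `ncard_fixed_formCongr_eq` onto the diagonal model, finite by
★ `finite_setOf_isVertexLattice_mapGL_diagonal_eq`.) [cite: Kottwitz1986BaseChangeUnits, §1 pp. 240–241] [cite: BruhatTits1972, §10] [cite: Rogawski1990, §4.9 pp. 54–55, Lemma 4.9.3] -/
theorem finite_setOf_isVertexLattice_mapGL_frameElt [Finite 𝓀[K]] (hσ : ∀ x, σ (σ x) = x) (hvσ : ∀ a, Valued.v (σ a) = Valued.v a)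
    (hϖ : Valued.v ϖ = WithZero.exp (-1 : ℤ)) (heven : ∀ x : K, σ x = x → x ≠ 0 → ∃ n : ℤ, Valued.v x = WithZero.exp (2 * n))
    {f : Fin 4 → Fin 3 → (Fin 3 → K)} (hf : IsFourFrameFamily σ f) (b : Fin 4) {α β : K}
    (hα : α * σ α = 1) (hβ : β * σ β = 1) (hαβ : α ≠ β) (hα1 : α ≠ 1) (hβ1 : β ≠ 1)
    (Γ : GL (Fin 3) K) (hΓ : (Γ : Matrix (Fin 3) (Fin 3) K) = frameElt σ f b α β) (t : ℕ) :
    {M : Submodule 𝒪[K] (Fin 3 → K) | IsVertexLattice σ ϖ ((StdForm.antidiagonal 3).over K) t M ∧ mapGL Γ M = M}.Finite := by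
  obtain ⟨A, d, hd, -, -, hA, hconj⟩ := exists_unimodular_diagonal_frame hσ hvσ hϖ heven hf b
  have hvα : Valued.v α = 1 := UnitaryLatticeTree.v_eq_one_of_mul_map_eq_one hvσ hα
  have hvβ : Valued.v β = 1 := UnitaryLatticeTree.v_eq_one_of_mul_map_eq_one hvσ hβ
  obtain ⟨T, hT⟩ := exists_GL_coe_eq_diagonal hvα hvβ
  have hΓ' : Γ = A * T * A⁻¹ := Units.ext (by rw [hΓ, hconj α β, Units.val_mul, Units.val_mul, hT])
  -- the diagonal model's fixed set is finite (regular unit diagonal)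
  have hs1 : ∀ i, Valued.v ((![α, β, 1] : Fin 3 → K) i) ≤ 1 := fun i => by
    fin_cases i <;> simp [hvα, hvβ]
  have hinj : Function.Injective (![α, β, 1] : Fin 3 → K) := by
    intro i j hij
    fin_cases i <;> fin_cases j
    all_goals first
      | rfl
      | (exfalso; simp at hij;
         first | exact hαβ hij | exact hαβ hij.symm | exact hα1 hij | exact hα1 hij.symm | exact hβ1 hij | exact hβ1 hij.symm)
  have hfin : {M : Submodule 𝒪[K] (Fin 3 → K) | IsVertexLattice σ ϖ (Matrix.diagonal d) t M ∧ mapGL T M = M}.Finite :=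
    finite_setOf_isVertexLattice_mapGL_diagonal_eq hvσ hϖ hd ![α, β, 1] hs1 hinj T hT t
  -- `M ↦ A·M` maps it ONTO ours
  refine (hfin.image (mapGL A)).subset fun M hM => ?_
  rw [Set.mem_setOf_eq] at hM
  refine ⟨mapGL A⁻¹ M, ?_, mapGL_mapGL_inv A M⟩
  rw [Set.mem_setOf_eq]
  constructor
  · -- a vertex of the model form `ᵗσ(A)Φ₃A = diag(d)`
    rw [← hA]
    exact (isVertexLattice_formCongr_iff (σ := σ) (ϖ := ϖ) A ((StdForm.antidiagonal 3).over K) t _).2 (by rw [mapGL_mapGL_inv]; exact hM.1)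
  · -- fixed by `T = diag(α, β, 1)`
    have h := (mapGL_conj_mapGL_eq_iff A T (mapGL A⁻¹ M)).1
    rw [mapGL_mapGL_inv, ← hΓ'] at h
    exact h hM.2

/-- The same at the SQUARE PARAMETERS of the κ-law binders (★ №1-R2 `KappaSignLawAtS2`: roots `a, b ∈ E¹`, element datum on `(a², b²)`, `Γ b′ = frameElt σ f b′ (a·a) (b·b)`), for all
four frames: each `{M | IsVertexLattice σ ϖ Φ₃ t M ∧ Γ_{b′}·M = M}` is finite. [cite: Kottwitz1986BaseChangeUnits, §1 pp. 240–241] [cite: Rogawski1990, §4.9 pp. 54–55, Lemma 4.9.3] -/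
theorem finite_setOf_isVertexLattice_mapGL_frameElt_of_isElementDatum [Finite 𝓀[K]] (hσ : ∀ x, σ (σ x) = x) (hvσ : ∀ a, Valued.v (σ a) = Valued.v a)
    (hϖ : Valued.v ϖ = WithZero.exp (-1 : ℤ)) (heven : ∀ x : K, σ x = x → x ≠ 0 → ∃ n : ℤ, Valued.v x = WithZero.exp (2 * n))
    {f : Fin 4 → Fin 3 → (Fin 3 → K)} (hf : IsFourFrameFamily σ f) {α β : K} {N₀ n₁ n₂ n₃ : ℕ} (hE : IsElementDatum σ ϖ N₀ α β n₁ n₂ n₃)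
    (Γ : Fin 4 → GL (Fin 3) K) (hΓ : ∀ b', (Γ b' : Matrix (Fin 3) (Fin 3) K) = frameElt σ f b' α β) (t : ℕ) (b' : Fin 4) :
    {M : Submodule 𝒪[K] (Fin 3 → K) | IsVertexLattice σ ϖ ((StdForm.antidiagonal 3).over K) t M ∧ mapGL (Γ b') M = M}.Finite := by
  obtain ⟨hα, hβ, hαβ, hα1, hβ1, -⟩ := hE
  exact finite_setOf_isVertexLattice_mapGL_frameElt hσ hvσ hϖ heven hf b' hα hβ hαβ hα1 hβ1 (Γ b') (hΓ b') t

end Summit.HodgeConjecture.HodgeConjecture.Cruxes.H413.F0P3cDyRamFrameEltFixedFinite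

end
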